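import Summits.ResolutionOfSingularities.ResolutionOfSingularities.Theorems.PurelyInseparableDim4SwapTransportWindowIter
import Summits.ResolutionOfSingularities.ResolutionOfSingularities.Theorems.PurelyInseparableDim4IsolationConverse
import Summits.ResolutionOfSingularities.ResolutionOfSingularities.Theorems.PurelyInseparableDim4FreeTailLemma
import Summits.ResolutionOfSingularities.ResolutionOfSingularities.Theorems.PurelyInseparableDim4ResConePowerChain
import Summits.ResolutionOfSingularities.ResolutionOfSingularities.Theorems.PurelyInseparableDim4IsolatedMultiplicity
import HarnessLib
import HarnessLib.Audit.Tags

/-!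
# Purely inseparable four-folds — THE VIRTUAL WINDOW FROM A SATELLITE ENTRY: the recursion data, a common isolation
# certificate, and the C∞ killer with rotations MODULO THE ENTRY (cell `res-dim4-pi`, K2(p) lane, slice B; K24b-R1 residual)

[OURS · counted 0 · cell `res-dim4-pi` · K24b-R1 (res-dim4-typ-1 g3).]  Nothing here proves K2(p)/K2(5), `NoIsolatedTrap 5 5`
or resolution of singularities in dimension ≥ 4 / characteristic `p` — NOT proved.  AI kernel work, weaker than expert review.

* §1 `exists_virtual_data` — the virtual charts / bijections / states `(ℓs, πs, Bs)` generated from an entry `(π₀, B₀)` by the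
  recursion rule of `virtual_step_any` EXIST (plain `Nat.rec`; no `def` in this file).
* §2 `cert_mono`, `exists_common_cert` — isolation certificates `𝔪₀ᴺ ≤ Sing ⊔ 𝔪₀ᴺ⁺¹` rise with `N`; a finite window of
  isolated states has a common level.
* §3 **`virtual_window_false_at`** — an entry at a real time `k` whose step re-creates the slot `π₀ λ` (slot step in the chart
  `π₀ λ`, or rotation translating `π₀ λ` away) and whose NEXT step is SATELLITE (`FreeTail.IsSatellite j b k`) feeds
  `virtual_window_false_of_entry` (`ℓs 0 = λ`, `ℓs 1 = μ` are read off the recursion rule).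
* §4 **`cInf_no_chain_of_entry`** — the binder block of res-dim4-p-3 g4's residual `hN4`
  (`ResCone.noAboveFloorTrap_five_iff_residual_two_of_rotation`, rotations allowed) implies `False` MODULO THE ENTRY
  EXISTENCE `hE` (beyond every index some time `k` with a framed virtual partner of `c k`, for every precision and jet —
  res-dim4-p-3 g4's (E0) `exists_virtual_entry`): free-tail lemma for a satellite time `s ≥ k`, `virtual_iterate` to
  `s`, `virtual_window_false_at` at `s`.  The K24b-R1 residual of record after this file is `hE` alone.
bears_on: LADDER-RESOLUTION:D157-DOOR2 (res-dim4-pi · K2(p) · slice B · K24b-R1).  Supports stmt-ResolutionOfSingularities-16155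
(helper).
-/

set_option linter.dupNamespace false -- mandated namespace of this single-conjunct summit

noncomputable section

namespace Summit.ResolutionOfSingularities.ResolutionOfSingularities.Theorems.PIDim4

namespace SwapTransport

open MvPolynomial Finset
open Literature.AlgebraicGeometry.Resolution
open Literature.AlgebraicGeometry.Resolution.CentreBlowup
open Literature.AlgebraicGeometry.Resolution.Hauser2010
open Literature.AlgebraicGeometry.Resolution.HauserPerlega2019

variable {K : Type} [Field K] [CharP K 5] [DecidableEq K]

/-! ## §1 The recursion data exist -/

omit [CharP K 5] in
/-- The virtual data generated by the recursion rule from an entry `(π₀, B₀)`. [OURS · bookkeeping] -/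
theorem exists_virtual_data (j : ℕ → Fin 4) (b : ℕ → Fin 4 → K) (k : ℕ) (la mu : Fin 4) (π₀ : Equiv.Perm (Fin 4))
    (B₀ : State K) :
    ∃ (πs : ℕ → Equiv.Perm (Fin 4)) (Bs : ℕ → State K) (ℓs : ℕ → Fin 4), πs 0 = π₀ ∧ Bs 0 = B₀ ∧
      (∀ t, Bs (t + 1) = CentreBlowup.step 5 Finset.univ (ℓs t) 0 (Bs t)) ∧
      (∀ t, ℓs t = if j (k + t) = πs t la then la else if j (k + t) = πs t mu then mu
        else if b (k + t) (πs t la) ≠ 0 then la else mu) ∧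
      (∀ t, πs (t + 1) = if j (k + t) = πs t la ∨ j (k + t) = πs t mu then πs t
        else (Equiv.swap (ℓs t) ((πs t).symm (j (k + t)))).trans (πs t)) := by
  let Φ : ℕ → Equiv.Perm (Fin 4) × State K := fun t => Nat.rec (π₀, B₀) (fun t q =>
    ((if j (k + t) = q.1 la ∨ j (k + t) = q.1 mu then q.1 else
        (Equiv.swap (if j (k + t) = q.1 la then la else if j (k + t) = q.1 mu then mu
          else if b (k + t) (q.1 la) ≠ 0 then la else mu) (q.1.symm (j (k + t)))).trans q.1),
      CentreBlowup.step 5 Finset.univ (if j (k + t) = q.1 la then la else if j (k + t) = q.1 mu then mu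
          else if b (k + t) (q.1 la) ≠ 0 then la else mu) 0 q.2)) t
  refine ⟨fun t => (Φ t).1, fun t => (Φ t).2, fun t => if j (k + t) = (Φ t).1 la then la else if j (k + t) = (Φ t).1 mu then mu
    else if b (k + t) ((Φ t).1 la) ≠ 0 then la else mu, rfl, rfl, fun t => rfl, fun t => rfl, fun t => rfl⟩

/-! ## §2 A common isolation certificate -/

omit [CharP K 5] [DecidableEq K] in
/-- Isolation certificates rise: `𝔪₀ᴺ ≤ S ⊔ 𝔪₀ᴺ⁺¹` and `N ≤ N′` give `𝔪₀^{N′} ≤ S ⊔ 𝔪₀^{N′+1}`. [folklore] -/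
theorem cert_mono {S : Ideal (MvPolynomial (Fin 4) K)} {N N' : ℕ} (h : originIdeal K ^ N ≤ S ⊔ originIdeal K ^ (N + 1))
    (hle : N ≤ N') : originIdeal K ^ N' ≤ S ⊔ originIdeal K ^ (N' + 1) := by
  induction hle with
  | refl => exact h
  | step _ ih =>
    calc originIdeal K ^ (_ + 1) = originIdeal K * originIdeal K ^ _ := pow_succ' _ _
      _ ≤ originIdeal K * (S ⊔ originIdeal K ^ (_ + 1)) := Ideal.mul_mono_right ih
      _ = originIdeal K * S ⊔ originIdeal K ^ (_ + 1 + 1) := by rw [Ideal.mul_sup, ← pow_succ']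
      _ ≤ S ⊔ originIdeal K ^ (_ + 1 + 1) := sup_le_sup_right Ideal.mul_le_left _

omit [CharP K 5] [DecidableEq K] in
/-- A finite window of isolated states has a common certificate level. [folklore] -/
theorem exists_common_cert {c : ℕ → State K} {k T : ℕ} (hiso : ∀ t, t ≤ T → IsIsolated 5 (c (k + t)).F) :
    ∃ Nc : ℕ, ∀ t, t ≤ T → originIdeal K ^ Nc ≤ singLocusIdeal 5 (c (k + t)).F ⊔ originIdeal K ^ (Nc + 1) := by
  induction T with
  | zero =>
    obtain ⟨N, hN⟩ := IsolationConverse.exists_certificate_of_isIsolated (hiso 0 le_rfl)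
    exact ⟨N, fun t ht => by obtain rfl : t = 0 := Nat.le_zero.mp ht; exact hN⟩
  | succ T ih =>
    obtain ⟨N₁, hN₁⟩ := ih fun t ht => hiso t (Nat.le_succ_of_le ht)
    obtain ⟨N₂, hN₂⟩ := IsolationConverse.exists_certificate_of_isIsolated (hiso (T + 1) le_rfl)
    refine ⟨max N₁ N₂, fun t ht => ?_⟩
    rcases Nat.lt_or_ge t (T + 1) with hlt | hge
    · exact cert_mono (hN₁ t (by omega)) (le_max_left _ _)
    · obtain rfl : t = T + 1 := le_antisymm ht hge
      exact cert_mono hN₂ (le_max_right _ _)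

/-! ## §3 The window from a satellite entry -/

/-- **THE VIRTUAL WINDOW FROM A SATELLITE ENTRY** (module docstring §3). [OURS] [cite: Hauser2010, §§F–G]
[cite: CossartJannsenSaito2020, Thm. 3.14] -/
theorem virtual_window_false_at {la mu u f : Fin 4} (hlm : la ≠ mu) (hlu : la ≠ u) (hlf : la ≠ f) (hmu : mu ≠ u)
    (hmf : mu ≠ f) (huf : u ≠ f) {c : ℕ → State K} {j : ℕ → Fin 4} {b : ℕ → Fin 4 → K}
    (hw : FreeTail.IsWitnessedChain 5 c j b) {k Nc : ℕ} (hisoR : ∀ t, t ≤ 9 → IsIsolated 5 (c (k + t)).F)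
    (hcert : ∀ t, t ≤ 9 → originIdeal K ^ Nc ≤ singLocusIdeal 5 (c (k + t)).F ⊔ originIdeal K ^ (Nc + 1))
    (hoR : ∀ t, t ≤ 9 → ordZero (c (k + t)).F = 6)
    (he3R : ∀ t, t ≤ 9 → Module.finrank K (ResCone.resVertex (c (k + t))) = 3)
    (hwtR : ∀ t, t ≤ 9 → (∀ i, (c (k + t)).r i ≤ 1) ∧ (c (k + t)).r.degree = 2)
    (hdivR : ∀ t, t ≤ 9 → ∀ d ∈ (c (k + t)).F.support, (c (k + t)).r ≤ d)
    {π₀ : Equiv.Perm (Fin 4)} {B₀ : State K} {M N : ℕ} (hM : Nc + 57 ≤ M) (hN : 48 ≤ N)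
    (hrel0 : ∃ (θ e : Fin 4 → MvPolynomial (Fin 4) K) (U E : MvPolynomial (Fin 4) K),
      θ (π₀ la) = X la * e la ∧ θ (π₀ mu) = X mu * e mu ∧ constantCoeff (e la) ≠ 0 ∧ constantCoeff (e mu) ≠ 0 ∧
      constantCoeff (θ (π₀ u)) = 0 ∧ constantCoeff (θ (π₀ f)) = 0 ∧
      coeff (Finsupp.single u 1) (θ (π₀ u)) * coeff (Finsupp.single f 1) (θ (π₀ f)) -
        coeff (Finsupp.single f 1) (θ (π₀ u)) * coeff (Finsupp.single u 1) (θ (π₀ f)) ≠ 0 ∧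
      constantCoeff U ≠ 0 ∧ E ∈ originIdeal K ^ M ∧ B₀.F = deletePthPowers 5 (U ^ 5 * aeval θ (c k).F) + E)
    (hrA0 : (c k).r = Finsupp.single (π₀ la) 1 + Finsupp.single (π₀ mu) 1)
    (hfr0 : ordZero B₀.F = 6 ∧ B₀.r = Finsupp.single la 1 + Finsupp.single mu 1 ∧
      (∀ d ∈ B₀.F.support, B₀.r ≤ d) ∧ (∃ a : K, a ≠ 0 ∧ ResCone.resForm B₀ = C a * X f ^ 4) ∧
      (∀ e ∈ B₀.F.support, e f ≤ 3 → 2 ≤ e la ∧ 2 ≤ e mu) ∧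
      (∀ d ∈ B₀.F.support, d.degree < N → ¬ (d u = 2 ∧ d f = 0)) ∧
      coeff (B₀.r + (Finsupp.single la 1 + Finsupp.single mu 1 + Finsupp.single u 3)) B₀.F ≠ 0 ∧
      IsIsolated 5 B₀.F ∧ Module.finrank K (ResCone.resVertex B₀) = 3)
    (hstart : j k = π₀ la ∨ (j k ≠ π₀ la ∧ j k ≠ π₀ mu ∧ b k (π₀ la) ≠ 0)) (hsat : FreeTail.IsSatellite j b k) :
    False := by
  obtain ⟨πs, Bs, ℓs, hπ0, hB0, hBs, hℓs, hπs⟩ := exists_virtual_data j b k la mu π₀ B₀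
  subst hπ0 hB0
  have hπlm : πs 0 la ≠ πs 0 mu := fun h => hlm ((πs 0).injective h)
  -- the first virtual chart is `λ`, and `πs 1 λ` is the newest real letter `j k`
  have hx0 : ℓs 0 = la := by
    rw [hℓs 0, Nat.add_zero]
    rcases hstart with h | ⟨h1, h2, h3⟩
    · rw [if_pos h]
    · rw [if_neg h1, if_neg h2, if_pos h3]
  have hπ1 : πs 1 la = j k := by
    rw [hπs 0, Nat.add_zero]
    rcases hstart with h | ⟨h1, h2, -⟩
    · rw [if_pos (Or.inl h), h]
    · rw [if_neg (not_or.mpr ⟨h1, h2⟩), hx0, Equiv.trans_apply, Equiv.swap_apply_left, Equiv.apply_symm_apply]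
  -- the satellite step `k + 1` charts the other slot: `ℓs 1 = μ`
  have hx1 : ℓs 1 = mu := by
    obtain ⟨hne, hb0⟩ := hsat
    rw [hℓs 1, hπ1, if_neg hne]
    by_cases h : j (k + 1) = πs 1 mu
    · rw [if_pos h]
    · rw [if_neg h, if_neg (not_not.mpr hb0)]
  exact virtual_window_false_of_entry hlm hlu hlf hmu hmf huf hw hisoR hcert hoR he3R hwtR hdivR hBs hℓs hπs hM hN hrel0 hrA0
    hfr0 hx0 hx1

/-! ## §4 The C∞ killer with rotations, modulo the entry -/

/-- **THE C∞ CONFIGURATION WITH ROTATIONS IS IMPOSSIBLE — MODULO THE ENTRY `hE`** (module docstring §4): the binder block of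
res-dim4-p-3 g4's `hN4` (`…LightResidualRotation`) gives `False` once, beyond every index, some time `k` carries a framed
virtual partner of `c k` along some `π₀` for every precision `M` and jet `N` (res-dim4-p-3 g4's (E0) `exists_virtual_entry`).
Route: satellite time `s ≥ k` (free-tail lemma `FreeTailProof.noIsolatedFreeTailAt_self`), `virtual_iterate` from `k` to `s`,
then `virtual_window_false_at` at `s` (naming `λ ↔ μ` by which slot the step at `s` re-creates, `step_cases_of_weights`). [OURS]
[cite: Hauser2010, §§F–G] [cite: CossartJannsenSaito2020, Thm. 3.14] -/
theorem cInf_no_chain_of_entry {c : ℕ → State K} {j : ℕ → Fin 4} {b : ℕ → Fin 4 → K}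
    (hc : ∀ k, IsIsolated 5 (c k).F ∧ Step0 5 (c k) (c (k + 1))) (hw : FreeTail.IsWitnessedChain 5 c j b)
    (hr0 : ∀ e ∈ (c 0).F.support, (c 0).r ≤ e) (hfloor : ∀ k, ordZero (c k).F ≠ (5 : ℕ)) {k₀ : ℕ}
    (hshade : ∀ k, k₀ ≤ k → (c k).shade = ((4 : ℕ) : ℕ∞))
    (he3 : ∀ k, k₀ ≤ k → Module.finrank K (ResCone.resVertex (c k)) = 3)
    (hwt : ∀ k, k₀ ≤ k → (∀ i, (c k).r i ≤ 1) ∧ (c k).r.degree = 2)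
    (hE : ∀ k₂, ∃ k, k₂ ≤ k ∧ ∃ (la mu u f : Fin 4) (π₀ : Equiv.Perm (Fin 4)),
      la ≠ mu ∧ la ≠ u ∧ la ≠ f ∧ mu ≠ u ∧ mu ≠ f ∧ u ≠ f ∧
      (c k).r = Finsupp.single (π₀ la) 1 + Finsupp.single (π₀ mu) 1 ∧
      ∀ M N : ℕ, ∃ B₀ : State K,
        (∃ (θ e : Fin 4 → MvPolynomial (Fin 4) K) (U E : MvPolynomial (Fin 4) K),
          θ (π₀ la) = X la * e la ∧ θ (π₀ mu) = X mu * e mu ∧ constantCoeff (e la) ≠ 0 ∧ constantCoeff (e mu) ≠ 0 ∧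
          constantCoeff (θ (π₀ u)) = 0 ∧ constantCoeff (θ (π₀ f)) = 0 ∧
          coeff (Finsupp.single u 1) (θ (π₀ u)) * coeff (Finsupp.single f 1) (θ (π₀ f)) -
            coeff (Finsupp.single f 1) (θ (π₀ u)) * coeff (Finsupp.single u 1) (θ (π₀ f)) ≠ 0 ∧
          constantCoeff U ≠ 0 ∧ E ∈ originIdeal K ^ M ∧ B₀.F = deletePthPowers 5 (U ^ 5 * aeval θ (c k).F) + E) ∧
        ordZero B₀.F = 6 ∧ B₀.r = Finsupp.single la 1 + Finsupp.single mu 1 ∧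
        (∀ d ∈ B₀.F.support, B₀.r ≤ d) ∧ (∃ a : K, a ≠ 0 ∧ ResCone.resForm B₀ = C a * X f ^ 4) ∧
        (∀ e ∈ B₀.F.support, e f ≤ 3 → 2 ≤ e la ∧ 2 ≤ e mu) ∧
        (∀ d ∈ B₀.F.support, d.degree < N → ¬ (d u = 2 ∧ d f = 0)) ∧
        coeff (B₀.r + (Finsupp.single la 1 + Finsupp.single mu 1 + Finsupp.single u 3)) B₀.F ≠ 0 ∧
        IsIsolated 5 B₀.F ∧ Module.finrank K (ResCone.resVertex B₀) = 3) : False := by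
  haveI : Fact (Nat.Prime 5) := ⟨by norm_num⟩
  obtain ⟨k, hk, la, mu, u, f, π₀, hlm, hlu, hlf, hmu, hmf, huf, hrA0, hB⟩ := hE k₀
  -- global regime facts
  have hiso : ∀ k, IsIsolated 5 (c k).F := fun k => (hc k).1
  have ho6 : ∀ m, k₀ ≤ m → ordZero (c m).F = 6 := fun m hm => by
    obtain ⟨o, ho, -, -, hod⟩ := ResCone.chain_shade_nat 5 hc hfloor hshade hm
    rw [(hwt m hm).2] at hod
    have h6 : o = 6 := by omega
    rw [ho, h6]; rfl
  have hdiv : ∀ m, ∀ d ∈ (c m).F.support, (c m).r ≤ d := IsolatedBand.isolated_chain_forall_le hc hr0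
  -- a satellite time `s = k + T`
  obtain ⟨s, hks, hsat⟩ := (FreeTail.satelliteRecurrenceAt_iff_noIsolatedFreeTailAt 5 5).mpr
    (FreeTailProof.noIsolatedFreeTailAt_self 5) K c j b hw hiso k
  obtain ⟨T, rfl⟩ : ∃ T, s = k + T := ⟨s - k, by omega⟩
  -- a common certificate on `c k, …, c (k + T + 9)`, the budgets, the entry and the virtual data
  obtain ⟨Nc, hcert⟩ := exists_common_cert (T := T + 9) (fun t _ => hiso (k + t))
  obtain ⟨B₀, hrel0, hfr0⟩ := hB (Nc + 57 + 5 * T) (48 + 4 * T)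
  obtain ⟨πs, Bs, ℓs, hπ0, hB0, hBs, hℓs, hπs⟩ := exists_virtual_data j b k la mu π₀ B₀
  subst hπ0 hB0
  -- phase 1: iterate to the satellite time
  obtain ⟨hrelT, hrAT, hfrT⟩ := virtual_iterate hlm hlu hlf hmu hmf huf hw (T := T) (fun t _ => hiso (k + t))
    (fun t ht => hcert t (by omega)) (fun t _ => ho6 (k + t) (by omega)) (fun t _ => he3 (k + t) (by omega))
    (fun t _ => hwt (k + t) (by omega)) (fun t _ => hdiv (k + t)) hBs hℓs hπs (by omega) (by omega) hrel0 hrA0 hfr0 T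
    le_rfl
  -- phase 2 inputs at the base `k + T`
  have hcertW : ∀ t, t ≤ 9 → originIdeal K ^ Nc ≤ singLocusIdeal 5 (c (k + T + t)).F ⊔ originIdeal K ^ (Nc + 1) :=
    fun t ht => by rw [Nat.add_assoc]; exact hcert (T + t) (by omega)
  have hisoW : ∀ t, t ≤ 9 → IsIsolated 5 (c (k + T + t)).F := fun t _ => hiso _
  have hoW : ∀ t, t ≤ 9 → ordZero (c (k + T + t)).F = 6 := fun t _ => ho6 _ (by omega)
  have he3W : ∀ t, t ≤ 9 → Module.finrank K (ResCone.resVertex (c (k + T + t))) = 3 := fun t _ => he3 _ (by omega)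
  have hwtW : ∀ t, t ≤ 9 → (∀ i, (c (k + T + t)).r i ≤ 1) ∧ (c (k + T + t)).r.degree = 2 :=
    fun t _ => hwt _ (by omega)
  have hdivW : ∀ t, t ≤ 9 → ∀ d ∈ (c (k + T + t)).F.support, (c (k + T + t)).r ≤ d := fun t _ => hdiv _
  have hM : Nc + 57 ≤ Nc + 57 + 5 * T - 5 * T := by omega
  have hN : 48 ≤ 48 + 4 * T - 4 * T := by omega
  -- the swapped-orientation copies
  obtain ⟨θ, e, U, E, h1, h2, h3, h4, h5, h6, h7, h8, h9, h10⟩ := hrelT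
  obtain ⟨hoT, hrT, hdivT, hformT, hledT, hrowT, hVT, hisoT, he3T⟩ := hfrT
  have hrelS : ∃ (θ e : Fin 4 → MvPolynomial (Fin 4) K) (U E : MvPolynomial (Fin 4) K),
      θ (πs T mu) = X mu * e mu ∧ θ (πs T la) = X la * e la ∧ constantCoeff (e mu) ≠ 0 ∧ constantCoeff (e la) ≠ 0 ∧
      constantCoeff (θ (πs T u)) = 0 ∧ constantCoeff (θ (πs T f)) = 0 ∧
      coeff (Finsupp.single u 1) (θ (πs T u)) * coeff (Finsupp.single f 1) (θ (πs T f)) -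
        coeff (Finsupp.single f 1) (θ (πs T u)) * coeff (Finsupp.single u 1) (θ (πs T f)) ≠ 0 ∧
      constantCoeff U ≠ 0 ∧ E ∈ originIdeal K ^ (Nc + 57 + 5 * T - 5 * T) ∧
      (Bs T).F = deletePthPowers 5 (U ^ 5 * aeval θ (c (k + T)).F) + E :=
    ⟨θ, e, U, E, h2, h1, h4, h3, h5, h6, h7, h8, h9, h10⟩
  have hrAS : (c (k + T)).r = Finsupp.single (πs T mu) 1 + Finsupp.single (πs T la) 1 := by rw [hrAT, add_comm]
  have hfrS : ordZero (Bs T).F = 6 ∧ (Bs T).r = Finsupp.single mu 1 + Finsupp.single la 1 ∧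
      (∀ d ∈ (Bs T).F.support, (Bs T).r ≤ d) ∧ (∃ a : K, a ≠ 0 ∧ ResCone.resForm (Bs T) = C a * X f ^ 4) ∧
      (∀ e ∈ (Bs T).F.support, e f ≤ 3 → 2 ≤ e mu ∧ 2 ≤ e la) ∧
      (∀ d ∈ (Bs T).F.support, d.degree < 48 + 4 * T - 4 * T → ¬ (d u = 2 ∧ d f = 0)) ∧
      coeff ((Bs T).r + (Finsupp.single mu 1 + Finsupp.single la 1 + Finsupp.single u 3)) (Bs T).F ≠ 0 ∧
      IsIsolated 5 (Bs T).F ∧ Module.finrank K (ResCone.resVertex (Bs T)) = 3 := by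
    refine ⟨hoT, by rw [hrT, add_comm], hdivT, hformT, fun e he hf => (hledT e he hf).symm, hrowT, ?_, hisoT, he3T⟩
    rw [add_comm (Finsupp.single mu 1) (Finsupp.single la 1)]; exact hVT
  -- which slot does the step at `k + T` re-create?
  have hπlm : πs T la ≠ πs T mu := fun h => hlm ((πs T).injective h)
  have hπlu : πs T la ≠ πs T u := fun h => hlu ((πs T).injective h)
  have hπlf : πs T la ≠ πs T f := fun h => hlf ((πs T).injective h)
  have hπmu : πs T mu ≠ πs T u := fun h => hmu ((πs T).injective h)
  have hπmf : πs T mu ≠ πs T f := fun h => hmf ((πs T).injective h)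
  have hπuf : πs T u ≠ πs T f := fun h => huf ((πs T).injective h)
  obtain ⟨-, -, -, -, hcs⟩ := hw (k + T)
  have hw1' : ∀ i, (CentreBlowup.step 5 Finset.univ (j (k + T)) (b (k + T)) (c (k + T))).r i ≤ 1 := fun i => by
    rw [← hcs]; exact (hwt (k + T + 1) (by omega)).1 i
  have hdeg' : (CentreBlowup.step 5 Finset.univ (j (k + T)) (b (k + T)) (c (k + T))).r.degree = 2 := by
    rw [← hcs]; exact (hwt (k + T + 1) (by omega)).2
  rcases step_cases_of_weights hπlm hπlu hπlf hπmu hπmf hπuf hrAT (ho6 (k + T) (by omega)) hw1' hdeg' with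
    ⟨hjr, -, -⟩ | ⟨hjr, -, -⟩ | ⟨hjr, hrot⟩
  · exact virtual_window_false_at hlm hlu hlf hmu hmf huf hw hisoW hcertW hoW he3W hwtW hdivW hM hN
      ⟨θ, e, U, E, h1, h2, h3, h4, h5, h6, h7, h8, h9, h10⟩ hrAT ⟨hoT, hrT, hdivT, hformT, hledT, hrowT, hVT, hisoT, he3T⟩
      (Or.inl hjr) hsat
  · exact virtual_window_false_at hlm.symm hmu hmf hlu hlf huf hw hisoW hcertW hoW he3W hwtW hdivW hM hN hrelS hrAS hfrS
      (Or.inl hjr) hsat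
  · have hjl : j (k + T) ≠ πs T la := by rcases hjr with h | h <;> rw [h] <;> [exact hπlu.symm; exact hπlf.symm]
    have hjm : j (k + T) ≠ πs T mu := by rcases hjr with h | h <;> rw [h] <;> [exact hπmu.symm; exact hπmf.symm]
    rcases hrot with ⟨hbla, -, -⟩ | ⟨hbmu, -, -⟩
    · exact virtual_window_false_at hlm hlu hlf hmu hmf huf hw hisoW hcertW hoW he3W hwtW hdivW hM hN
        ⟨θ, e, U, E, h1, h2, h3, h4, h5, h6, h7, h8, h9, h10⟩ hrAT ⟨hoT, hrT, hdivT, hformT, hledT, hrowT, hVT, hisoT, he3T⟩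
        (Or.inr ⟨hjl, hjm, hbla⟩) hsat
    · exact virtual_window_false_at hlm.symm hmu hmf hlu hlf huf hw hisoW hcertW hoW he3W hwtW hdivW hM hN hrelS hrAS
        hfrS (Or.inr ⟨hjm, hjl, hbmu⟩) hsat

end SwapTransport

end Summit.ResolutionOfSingularities.ResolutionOfSingularities.Theorems.PIDim4

end
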